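import Literature.NumberTheory.EllipticCurves.ZpExtensionEisensteinTwistFreeProofs
import Literature.NumberTheory.EllipticCurves.ZpExtensionEisensteinTwistDualityForm
import Literature.NumberTheory.EllipticCurves.IwasawaAlgebraEisensteinFiniteQuotientSpanProofs
import Literature.NumberTheory.EllipticCurves.IwasawaAlgebraEisensteinUnitCoeffNotDvdProofs
import Literature.NumberTheory.EllipticCurves.IwasawaAlgebraEisensteinCoefficientRingProofs
import Literature.NumberTheory.EllipticCurves.TateModuleCayleyHamiltonTorsionProofs
import Literature.NumberTheory.EllipticCurves.BSDSelmerPConverseSerreProofs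
import Literature.NumberTheory.EllipticCurves.GeomPointsGaloisModule
import Literature.Algebra.Module.EigenvectorAnnihilatorCountProofs
import HarnessLib

/-!
# A bound, UNIFORM IN THE LEVEL, on the twisted eigenvectors of one Galois element on Howard's Eisenstein levels
# `E[p^j] ⊗ A_{m,j}(ψ)` (proofs)

`Proofs` file (theorems only; no definition, no named fact, no instance) in topic `NumberTheory/EllipticCurves`.

Setting: `K` a field with `p ≠ 0`, `E = W` an elliptic curve over `K`, `κ : Γ_K ↠ ℤ_p` a `ℤ_p`-extension, `m ≥ 1`, and
Howard's specialised modules `W_{m,j} = E[p^j] ⊗ A_{m,j}(ψ)` at the Eisenstein prime `𝔮 = (T^m + p)`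
(`ZpExtension.eisensteinTwist κ (torsionGaloisModule (p^j)) hm j` on `EisensteinCoeff.Twisted p m j E[p^j]`,
`A_{m,j} = Λ/(T^m + p, p^j)`; [Howard 2004] §2.2, proof of Thm. 2.2.10).  Let `σ₀ ∈ Γ_K` be an element with
`κ(σ₀) = N ∈ ℕ`, `N ≥ 1` (for a local Galois group at a finitely decomposed place such an element exists: the image of
the decomposition group is a non-zero closed subgroup `p^s ℤ_p` of `ℤ_p`).  Then `σ₀` acts on `W_{m,j}` as
`φ = (1+T)^N ⊗ ρ_j(σ₀)`; by Cayley–Hamilton on `T_p E` (`exists_cayleyHamilton_torsion`: `X² + a₁X + a₀`, `a₀` a unit)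
`φ² + a₁(1+T)^N φ + a₀(1+T)^{2N} = 0`, so every `w` with `φ w = ℓ w` (`ℓ ∈ ℤ_p`) is killed by the image of the
`j`-INDEPENDENT element `Δ_ℓ = ℓ² + a₁ℓ(1+T)^N + a₀(1+T)^{2N} ∈ Λ`, whose coefficient in degree `2N` is the unit `a₀`;
hence for `m > 2N` it is non-zero in the DVR `S_m = Λ/(T^m + p)` (`finite_quotient_span_charTwistElement`) and, `W_{m,j}`
being free of rank two over `A_{m,j}` (`Twisted.basisOfAddEquiv`, H.0),

  **`#{w ∈ W_{m,j} : σ₀ · w = ℓ w} ≤ #(S_m/(Δ̄_ℓ))²`  for every `j ≥ 1`**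

(`natCard_setOf_eisensteinTwist_apply_eq_smul_le`; `ℓ = 1`: the fixed points of `σ₀`, which contain the local
invariants `H⁰(K_v, W_{m,j})` when `σ₀` comes from `Γ_{K_v}` — `natCard_setOf_eisensteinTwist_apply_eq_self_le`).
No reduction type, Tate curve or Frobenius eigenvalue enters: this is the `E`-arithmetic-free core of the uniform local
bounds at the places `v ∣ N` in hypothesis H.4 of [Howard 2004] for `T_𝔮` (cell `pub/bsd-print-x9`).

References: [Howard2004HeegnerKolyvagin] B. Howard, Compositio Math. 140 (2004), §1.3 H.4, §2.2, proof of Thm. 2.2.10;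
[GreenbergLNM1716] R. Greenberg, LNM 1716 (1999), proof of Prop. 4.15 (finiteness of twisted local invariants for almost
all twists — the cyclotomic analogue); [SilvermanAEC2009] Prop. III.7.1. BSD is not proved by any of this.
-/

noncomputable section

open Polynomial Field

universe u

namespace Literature.NumberTheory.EllipticCurves

namespace ZpExtension

open IwasawaAlgebra IwasawaAlgebra.EisensteinCoeff Literature.NumberTheory.GaloisRepresentations
  Literature.Algebra.Module

variable {K : Type u} [Field K] (W : WeierstrassCurve K) [W.IsElliptic] {p : ℕ} [hp : Fact p.Prime]
  (κ : ZpExtension K p) {m : ℕ} (hm : 1 ≤ m)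

/-- `(1+T)^{κ(σ₀) mod p^J} = (1+T)^N` in `A_{m,j}` when `κ(σ₀) = N ∈ ℕ` and `J = eisensteinLevel` (where `(1+T)^{p^J} = 1`).
[cite: Howard2004HeegnerKolyvagin, §2.2 (Γ_K acts on Λ through γ ↦ 1 + T)] -/
theorem onePlusT_pow_twistExponent_eq_of_toAdd_eq_natCast (j : ℕ) {σ₀ : absoluteGaloisGroup K} {N : ℕ}
    (hσ : (κ σ₀).toAdd = (N : ℤ_[p])) :
    onePlusT p m j ^ κ.twistExponent (eisensteinLevel (p := p) hm j) σ₀ = onePlusT p m j ^ N := by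
  have hexp : κ.twistExponent (eisensteinLevel (p := p) hm j) σ₀ = N % p ^ eisensteinLevel (p := p) hm j := by
    rw [twistExponent, hσ, map_natCast, ZMod.val_natCast]
  rw [hexp]
  conv_rhs => rw [← Nat.div_add_mod N (p ^ eisensteinLevel (p := p) hm j), pow_add, pow_mul,
    onePlusT_pow_prime_pow_eisensteinLevel, one_pow, one_mul]

/-- **Uniform bound on the twisted `ℓ`-eigenvectors of one Galois element on `E[p^j] ⊗ A_{m,j}(ψ)`.** Let `κ(σ₀) = N ≥ 1`
and `m > 2N`. There are `a₁, a₀ ∈ ℤ_p` with `a₀` a unit (the characteristic polynomial of `σ₀` on `T_p E`) such that for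
EVERY `j ≥ 1` and every `ℓ ∈ ℤ_p`, with `Δ_ℓ = ℓ² + a₁ℓ(1+T)^N + a₀(1+T)^{2N} ∈ Λ` (non-zero in `S_m = Λ/(T^m+p)`,
`S_m/(Δ̄_ℓ)` finite):
`#{w ∈ E[p^j] ⊗ A_{m,j}(ψ) : σ₀ · w = ℓ • w} ≤ #(S_m/(Δ̄_ℓ))²`.
[cite: Howard2004HeegnerKolyvagin, §1.3 H.4 and §2.2, proof of Thm. 2.2.10] [cite: GreenbergLNM1716, proof of Prop. 4.15] -/
theorem natCard_setOf_eisensteinTwist_apply_eq_smul_le (hpK : (p : K) ≠ 0) {σ₀ : absoluteGaloisGroup K} {N : ℕ}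
    (hN : 1 ≤ N) (hσ : (κ σ₀).toAdd = (N : ℤ_[p])) (hmN : 2 * N < m) :
    ∃ a₁ a₀ : ℤ_[p], IsUnit a₀ ∧ ∀ (j : ℕ) (_hj : 1 ≤ j) (ℓ : ℤ_[p]),
      Finite ((IwasawaAlgebra p ⧸ Ideal.span {(PowerSeries.X ^ m + PowerSeries.C (p : ℤ_[p]) : IwasawaAlgebra p)}) ⧸
        Ideal.span {Ideal.Quotient.mk (Ideal.span {(PowerSeries.X ^ m + PowerSeries.C (p : ℤ_[p]) : IwasawaAlgebra p)})
          (PowerSeries.C (ℓ ^ 2) + PowerSeries.C (a₁ * ℓ) * ((1 : IwasawaAlgebra p) + PowerSeries.X) ^ N +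
            PowerSeries.C a₀ * ((1 : IwasawaAlgebra p) + PowerSeries.X) ^ (2 * N))}) ∧
      Nat.card {w : Twisted p m j (W.geomTorsion ((p : ℤ) ^ j)) |
          κ.eisensteinTwist (W.torsionGaloisModule ((p : ℤ) ^ j)) hm j σ₀ w =
            algebraMap ℤ_[p] (EisensteinCoeff p m j) ℓ • w} ≤
        Nat.card ((IwasawaAlgebra p ⧸ Ideal.span {(PowerSeries.X ^ m + PowerSeries.C (p : ℤ_[p]) : IwasawaAlgebra p)}) ⧸
          Ideal.span {Ideal.Quotient.mk (Ideal.span {(PowerSeries.X ^ m + PowerSeries.C (p : ℤ_[p]) : IwasawaAlgebra p)})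
            (PowerSeries.C (ℓ ^ 2) + PowerSeries.C (a₁ * ℓ) * ((1 : IwasawaAlgebra p) + PowerSeries.X) ^ N +
              PowerSeries.C a₀ * ((1 : IwasawaAlgebra p) + PowerSeries.X) ^ (2 * N))}) ^ 2 := by
  obtain ⟨a₁, a₀, ha₀, hCH⟩ := W.exists_cayleyHamilton_torsion p hpK σ₀
  refine ⟨a₁, a₀, ha₀, fun j hj ℓ ↦ ?_⟩
  obtain ⟨hne, hfin⟩ := finite_quotient_span_charTwistElement p (m := m) a₁ ℓ ha₀ hN hmN
  refine ⟨hfin, ?_⟩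
  haveI := hfin
  -- abbreviations
  set A := EisensteinCoeff p m j with hA
  haveI : Finite A := finite_quotient_span_qm_sup_span_C_pow p hm j
  set M := ↥(W.geomTorsion ((p : ℤ) ^ j)) with hM
  set ρ := W.torsionGaloisModule ((p : ℤ) ^ j) with hρ
  set u : A := onePlusT p m j ^ N with hu
  set μ : A := algebraMap ℤ_[p] A ℓ with hμ
  -- the level ring constants `a₁, a₀ mod p^j` as natural-number casts
  have hcast : ∀ a : ℤ_[p], algebraMap ℤ_[p] A a = ((PadicInt.toZModPow j a).val : A) := fun a ↦ by
    rw [EisensteinCoeff.algebraMap_padicInt_eq_ofZMod_toZModPow p hm j, EisensteinCoeff.ofZMod_apply]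
  -- the twisted action of `σ₀` as an `A`-linear endomorphism
  let φ : Module.End A (Twisted p m j M) :=
    { toFun := fun w ↦ κ.eisensteinTwist ρ hm j σ₀ w
      map_add' := fun x y ↦ map_add _ x y
      map_smul' := fun c x ↦ κ.eisensteinTwist_apply_smul ρ hm j σ₀ c x }
  have hφ : ∀ w, φ w = κ.eisensteinTwist ρ hm j σ₀ w := fun _ ↦ rfl
  have hφt : ∀ (c : A) (a : M), φ (Twisted.tmul c a) = Twisted.tmul (u * c) (σ₀ • a) := fun c a ↦ by
    rw [hφ, eisensteinTwist_apply_tmul, κ.onePlusT_pow_twistExponent_eq_of_toAdd_eq_natCast hm j hσ, hρ,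
      WeierstrassCurve.torsionGaloisModule_apply_apply]
  -- Cayley–Hamilton at level `j`, inside `E[p^j]`
  have hCHj : ∀ a : M, σ₀ • σ₀ • a + (PadicInt.toZModPow j a₁).val • σ₀ • a + (PadicInt.toZModPow j a₀).val • a = 0 :=
    fun a ↦ by
    have ha : ((p : ℤ) ^ j) • (a : W.geomPoints) = 0 := (Submodule.mem_torsionBy_iff _ _).1 a.2
    have h := hCH j (a : W.geomPoints) ha
    apply Subtype.ext
    rw [natCast_zsmul, natCast_zsmul] at h
    have e : ((σ₀ • σ₀ • a + (PadicInt.toZModPow j a₁).val • σ₀ • a + (PadicInt.toZModPow j a₀).val • a : M) :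
        W.geomPoints) = σ₀ • σ₀ • (a : W.geomPoints) + (PadicInt.toZModPow j a₁).val • σ₀ • (a : W.geomPoints) +
          (PadicInt.toZModPow j a₀).val • (a : W.geomPoints) := rfl
    rw [e, h]
    rfl
  -- the homogenised characteristic polynomial kills `φ`
  set b₁ : A := algebraMap ℤ_[p] A a₁ * u with hb₁
  set b₀ : A := algebraMap ℤ_[p] A a₀ * u ^ 2 with hb₀
  set P : A[X] := X ^ 2 + C b₁ * X + C b₀ with hPdef
  have hP : aeval φ P = 0 := by
    refine LinearMap.ext fun w ↦ ?_
    induction w using Twisted.induction_on with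
    | zero => rw [map_zero, LinearMap.zero_apply]
    | add x y hx hy => rw [map_add, hx, hy, LinearMap.zero_apply, LinearMap.zero_apply, LinearMap.zero_apply, add_zero]
    | tmul c a =>
      rw [LinearMap.zero_apply, hPdef]
      simp only [map_add, map_mul, aeval_X, aeval_C, LinearMap.add_apply, Module.End.mul_apply,
        Module.algebraMap_end_apply, pow_two]
      have e1 : b₁ * (u * c) = ((PadicInt.toZModPow j a₁).val : A) * (u * (u * c)) := by rw [hb₁, hcast]; ring
      have e2 : b₀ * c = ((PadicInt.toZModPow j a₀).val : A) * (u * (u * c)) := by rw [hb₀, hcast]; ring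
      rw [hφt, hφt, Twisted.smul_tmul, Twisted.smul_tmul, e1, e2, ← nsmul_eq_mul, ← nsmul_eq_mul,
        Twisted.nsmul_tmul, Twisted.nsmul_tmul, ← Twisted.tmul_add, ← Twisted.tmul_add, hCHj, Twisted.tmul_zero]
  -- a basis of `W_{m,j}` over `A` with two elements (H.0)
  obtain ⟨e⟩ := nonempty_addEquiv_geomTorsion W p j hj hpK
  have hidx : W.geomTorsion ((p ^ j : ℕ) : ℤ) = W.geomTorsion ((p : ℤ) ^ j) := by rw [Nat.cast_pow]
  let e' : M ≃+ (Fin 2 → ZMod (p ^ j)) := (AddEquiv.addSubgroupCongr hidx).symm.trans e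
  let b : Module.Basis (Fin 2) A (Twisted p m j M) := Twisted.basisOfAddEquiv e'
  -- the annihilator `Δ_ℓ` maps to `P(μ)`
  set Δ := Ideal.Quotient.mk (Ideal.span {(PowerSeries.X ^ m + PowerSeries.C (p : ℤ_[p]) : IwasawaAlgebra p)})
    (PowerSeries.C (ℓ ^ 2) + PowerSeries.C (a₁ * ℓ) * ((1 : IwasawaAlgebra p) + PowerSeries.X) ^ N +
      PowerSeries.C a₀ * ((1 : IwasawaAlgebra p) + PowerSeries.X) ^ (2 * N)) with hΔdef
  set oX : IwasawaAlgebra p := (1 : IwasawaAlgebra p) + PowerSeries.X with hoX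
  have hmkC : ∀ a : ℤ_[p], (Ideal.Quotient.mk (Ideal.span {(PowerSeries.X ^ m + PowerSeries.C (p : ℤ_[p]) :
      IwasawaAlgebra p)} ⊔ Ideal.span {PowerSeries.C ((p : ℤ_[p]) ^ j)}) (PowerSeries.C a) : A) = algebraMap ℤ_[p] A a :=
    fun a ↦ by
    rw [← Ideal.Quotient.mk_comp_algebraMap, RingHom.comp_apply]
    rfl
  have hmk1X : (Ideal.Quotient.mk (Ideal.span {(PowerSeries.X ^ m + PowerSeries.C (p : ℤ_[p]) : IwasawaAlgebra p)} ⊔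
      Ideal.span {PowerSeries.C ((p : ℤ_[p]) ^ j)}) oX : A) = onePlusT p m j :=
    rfl
  have hΔ : EisensteinCoeff.ofSpec p m j Δ = P.eval μ := by
    rw [hΔdef, EisensteinCoeff.ofSpec_mk, hPdef]
    simp only [map_add, map_mul, map_pow, hmkC, hmk1X, eval_add, eval_mul, eval_pow, eval_X, eval_C]
    rw [hb₁, hb₀, hμ, hu]
    ring
  -- count
  have hcount : Nat.card {w : Twisted p m j M | φ w = μ • w} ≤
      Nat.card ((IwasawaAlgebra p ⧸ Ideal.span {(PowerSeries.X ^ m + PowerSeries.C (p : ℤ_[p]) : IwasawaAlgebra p)}) ⧸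
        Ideal.span {Δ}) ^ Fintype.card (Fin 2) := by
    refine (natCard_setOf_apply_eq_smul_le_pow b hP μ).trans (Nat.pow_le_pow_left ?_ _)
    rw [natCard_torsionBy_eq_natCard_quotient_span, ← hΔ]
    exact natCard_quotient_span_map_le _ (EisensteinCoeff.ofSpec_surjective (p := p) m j) Δ
  simpa only [Fintype.card_fin, hφ] using hcount

/-- **Uniform bound on the fixed points** (`ℓ = 1`): with `Δ₁ = 1 + a₁(1+T)^N + a₀(1+T)^{2N}`,
`#{w ∈ E[p^j] ⊗ A_{m,j}(ψ) : σ₀ · w = w} ≤ #(S_m/(Δ̄₁))²` for every `j ≥ 1` — in particular for the local invariants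
`H⁰(K_v, E[p^j] ⊗ A_{m,j}(ψ)) ⊆ {w : σ₀ · w = w}` when `σ₀` is the image of an element of `Γ_{K_v}`.
[cite: Howard2004HeegnerKolyvagin, §1.3 H.4 and §2.2] [cite: GreenbergLNM1716, proof of Prop. 4.15] -/
theorem natCard_setOf_eisensteinTwist_apply_eq_self_le (hpK : (p : K) ≠ 0) {σ₀ : absoluteGaloisGroup K} {N : ℕ}
    (hN : 1 ≤ N) (hσ : (κ σ₀).toAdd = (N : ℤ_[p])) (hmN : 2 * N < m) :
    ∃ a₁ a₀ : ℤ_[p], IsUnit a₀ ∧ ∀ (j : ℕ) (_hj : 1 ≤ j),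
      Finite ((IwasawaAlgebra p ⧸ Ideal.span {(PowerSeries.X ^ m + PowerSeries.C (p : ℤ_[p]) : IwasawaAlgebra p)}) ⧸
        Ideal.span {Ideal.Quotient.mk (Ideal.span {(PowerSeries.X ^ m + PowerSeries.C (p : ℤ_[p]) : IwasawaAlgebra p)})
          (1 + PowerSeries.C a₁ * ((1 : IwasawaAlgebra p) + PowerSeries.X) ^ N +
            PowerSeries.C a₀ * ((1 : IwasawaAlgebra p) + PowerSeries.X) ^ (2 * N))}) ∧
      Nat.card {w : Twisted p m j (W.geomTorsion ((p : ℤ) ^ j)) |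
          κ.eisensteinTwist (W.torsionGaloisModule ((p : ℤ) ^ j)) hm j σ₀ w = w} ≤
        Nat.card ((IwasawaAlgebra p ⧸ Ideal.span {(PowerSeries.X ^ m + PowerSeries.C (p : ℤ_[p]) : IwasawaAlgebra p)}) ⧸
          Ideal.span {Ideal.Quotient.mk (Ideal.span {(PowerSeries.X ^ m + PowerSeries.C (p : ℤ_[p]) : IwasawaAlgebra p)})
            (1 + PowerSeries.C a₁ * ((1 : IwasawaAlgebra p) + PowerSeries.X) ^ N +
              PowerSeries.C a₀ * ((1 : IwasawaAlgebra p) + PowerSeries.X) ^ (2 * N))}) ^ 2 := by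
  obtain ⟨a₁, a₀, ha₀, h⟩ := κ.natCard_setOf_eisensteinTwist_apply_eq_smul_le W hm hpK hN hσ hmN
  refine ⟨a₁, a₀, ha₀, fun j hj ↦ ?_⟩
  have h1 := h j hj 1
  simpa only [one_pow, mul_one, map_one, one_smul] using h1

end ZpExtension

end Literature.NumberTheory.EllipticCurves

end
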